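import Summits.AtomisticToContinuum.Crystallization.Theorems.GappedShellCensusCleanLimitsHaveWindowsCleanChartTSteps1
import Summits.AtomisticToContinuum.Crystallization.Theorems.GappedShellCensusCleanLimitsHaveWindowsCleanChartTGlobalC
import Summits.AtomisticToContinuum.Crystallization.Theorems.GappedShellCensusCleanLimitsHaveWindowsCleanChartTGlobalD
import Summits.AtomisticToContinuum.Crystallization.Theorems.GappedShellCensusCleanLimitsHaveWindowsCleanChartTGlobalF
import Summits.AtomisticToContinuum.Crystallization.Theorems.PalmUnimodularRigidityShellsToBarlowChartTransportGlobalG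

/-!
# `CleanLimitsHaveWindows` (stmt-AtomisticToContinuum-15932), line `Sketch` — stub K1 (`stub_cleanChart`):
# the transport development re-run on CLEAN charts — copy of `PalmUnimodularRigidityShellsToBarlowChartTransportGlobalG`

This file is a mechanical copy of `Theorems/PalmUnimodularRigidityShellsToBarlowChartTransportGlobalG.lean` (crux `ShellsToBarlowChart`,
route `PalmUnimodularRigidity`; original title: Line `develop-the-model-growth-descent` (crux `ShellsToBarlowChart`, stmt-AtomisticToContinuum-9227): reachability and the transport system (modulo connectivity of the window graph))
in which the chart hypothesis `hch : ∀ z ∈ S, IsZChart S z (ac z) (Pc z) (Ac z) (nb z)` (integer charts with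
`1 %` closeness) is replaced by the CLEAN-CHART hypothesis: at every site a labelling of the bonded neighbours
by `fcc3Int`/`hcpInt`, bijective, with bonds among neighbours = label pairs at squared distance `18`, together
with the TRANSFER property across every bond (proved for clean sets at matching radius `1/5` in
`…CleanChartTransfer`).  The original development uses its metric hypothesis only through the transfer
lemma, so all proofs go through verbatim; declarations live in the sub-namespace `….Clean` and shadow the
originals, the `hch`-free lemmas of the original file are reused, not restated.  All `[folklore]`.
-/

noncomputable section

namespace Summit.AtomisticToContinuum.Crystallization.Theorems.PalmUnimodularRigidityShellsToBarlowChart.Clean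

open Literature.Geometry.DiscreteGeometry Literature.MathematicalPhysics.StatisticalMechanics
open Summit.AtomisticToContinuum.Crystallization.Theorems.ShellsToBarlowChartNegative

variable {S : Set (EuclideanSpace ℝ (Fin 3))} {Pc : (EuclideanSpace ℝ (Fin 3)) → Finset (Fin 3 → ℤ)}
  {nb : (EuclideanSpace ℝ (Fin 3)) → (Fin 3 → ℤ) → (EuclideanSpace ℝ (Fin 3))}

/-- **Reachability**: every site joined to the base point by a walk in the window graph is a
point of the development (STAR surjectivity along the walk). [folklore] -/
theorem reach (hch : ((∀ z ∈ S, (Pc z = fcc3Int ∨ Pc z = hcpInt) ∧ Set.BijOn (nb z) (↑(Pc z) : Set (Fin 3 → ℤ)) {y | y ∈ S ∧ (0 < dist z y ∧ dist z y ≤ 28 / 25)} ∧ (∀ t ∈ Pc z, ∀ t' ∈ Pc z, ((0 < dist (nb z t) (nb z t') ∧ dist (nb z t) (nb z t') ≤ 28 / 25) ↔ sqNormInt (t - t') = 18))) ∧ (∀ x ∈ S, ∀ y ∈ S, (0 < dist x y ∧ dist x y ≤ 28 / 25) → ∀ t ∈ Pc x, ∀ t' ∈ Pc x, ∀ u ∈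 Pc y, ∀ u' ∈ Pc y, nb y u = nb x t → nb y u' = nb x t' → sqNormInt (u - u') = sqNormInt (t - t')))) {g₀ : ZFrame} (h₀ : IsFrame (Pc g₀.pt) g₀.t₁ g₀.t₂ g₀.U) (h₀S : g₀.pt ∈ S) (h₀p : frameParity g₀.t₁ g₀.t₂ g₀.U = 1) (h₀A : (∀ z ∈ S, Pc z = fcc3Int) ∨ Pc g₀.pt = hcpInt) {u v : (EuclideanSpace ℝ (Fin 3))} (w : (windowGraph S).Walk u v) (hu : ∃ k i j : ℤ, (frameAt Pc nb g₀ k i j).pt = u) : ∃ k i j : ℤ, (frameAt Pc nb g₀ k i j).pt = v := by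
  induction w with
  | nil => exact hu
  | @cons a b _ hadj _ ih =>
    apply ih
    obtain ⟨k, i, j, hk⟩ := hu
    rcases h : frameAt Pc nb g₀ k i j with ⟨x, t₁, t₂, U⟩
    have hxa : x = a := by rw [← hk, h]
    subst hxa
    have hb : b ∈ S ∧ (0 < dist x b ∧ dist x b ≤ 28 / 25) := by
      rw [windowGraph, SimpleGraph.fromRel_adj] at hadj
      rcases hadj.2 with ⟨-, hbS, hbond⟩ | ⟨hbS, -, hbond⟩
      · exact ⟨hbS, hbond⟩
      · exact ⟨hbS, by rw [dist_comm]; exact hbond.1, by rw [dist_comm]; exact hbond.2⟩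
    obtain ⟨⟨-, -, hsurj⟩, -⟩ := star_at hch h₀ h₀S h₀p h₀A k i j h rfl rfl
    obtain ⟨y, -, hy⟩ := hsurj hb
    exact ⟨k + y.1, i - y.2.1, j - y.2.2, hy⟩

/-- **The transport system of a good-shell configuration** (the geometric half of the line),
assuming the window graph is connected. [folklore] -/
theorem transportSystem_of_connected (hne : S.Nonempty) (hch : ((∀ z ∈ S, (Pc z = fcc3Int ∨ Pc z = hcpInt) ∧ Set.BijOn (nb z) (↑(Pc z) : Set (Fin 3 → ℤ)) {y | y ∈ S ∧ (0 < dist z y ∧ dist z y ≤ 28 / 25)} ∧ (∀ t ∈ Pc z, ∀ t' ∈ Pc z, ((0 < dist (nb z t) (nb z t') ∧ dist (nb z t) (nb z t') ≤ 28 / 25) ↔ sqNormInt (t - t') = 18))) ∧ (∀ x ∈ S, ∀ y ∈ S, (0 < dist x y ∧ dist x y ≤ 28 / 25) → ∀ t ∈ Pc x, ∀ t' ∈ Pc x, ∀ u ∈ Pc y, ∀ u' ∈ Pc y, nb y u = nb x t → nb y u' = nb x t' → sqNormInt (u - u') = sqNormInt (t - t'))))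
    (hconn : ∀ x ∈ S, ∀ y ∈ S, Nonempty ((windowGraph S).Walk x y)) : TransportSystem S := by
  classical
  -- a base frame of parity `+1`, in the base regime
  have hbase : ∃ g₀ : ZFrame, IsFrame (Pc g₀.pt) g₀.t₁ g₀.t₂ g₀.U ∧ g₀.pt ∈ S ∧
      frameParity g₀.t₁ g₀.t₂ g₀.U = 1 ∧ ((∀ z ∈ S, Pc z = fcc3Int) ∨ Pc g₀.pt = hcpInt) := by
    by_cases hB : ∃ x₀ ∈ S, Pc x₀ = hcpInt
    · obtain ⟨x₀, hx₀, hP⟩ := hB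
      refine ⟨⟨x₀, ![-3, 3, 0], ![-3, 0, 3], {![0, 3, 3], ![3, 0, 3], ![3, 3, 0]}⟩, ?_, hx₀, ?_, Or.inr hP⟩
      · show IsFrame (Pc x₀) ![-3, 3, 0] ![-3, 0, 3] {![0, 3, 3], ![3, 0, 3], ![3, 3, 0]}
        rw [hP]; decide
      · show frameParity ![-3, 3, 0] ![-3, 0, 3] {![0, 3, 3], ![3, 0, 3], ![3, 3, 0]} = 1
        decide
    · push Not at hB
      obtain ⟨x₀, hx₀⟩ := hne
      have hF : ∀ z ∈ S, Pc z = fcc3Int := fun z hz => (pattern_cases hch hz).resolve_right (hB z hz)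
      refine ⟨⟨x₀, ![3, 3, 0], ![3, 0, 3], {![0, 3, 3], ![-3, 0, 3], ![-3, 3, 0]}⟩, ?_, hx₀, ?_, Or.inl hF⟩
      · show IsFrame (Pc x₀) ![3, 3, 0] ![3, 0, 3] {![0, 3, 3], ![-3, 0, 3], ![-3, 3, 0]}
        rw [hF x₀ hx₀]; decide
      · show frameParity ![3, 3, 0] ![3, 0, 3] {![0, 3, 3], ![-3, 0, 3], ![-3, 3, 0]} = 1
        decide
  obtain ⟨g₀, h₀, h₀S, h₀p, h₀A⟩ := hbase
  obtain ⟨hval, hS, hI, hJ, -, -⟩ := layers (Pc := Pc) (nb := nb) hch h₀ h₀S h₀p h₀A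
  -- the three shifts of `ℤ³`
  let Ish : Equiv.Perm (ℤ × ℤ × ℤ) :=
    ⟨fun f => (f.1, f.2.1 + 1, f.2.2), fun f => (f.1, f.2.1 - 1, f.2.2), fun f => by simp, fun f => by simp⟩
  let Jsh : Equiv.Perm (ℤ × ℤ × ℤ) :=
    ⟨fun f => (f.1, f.2.1, f.2.2 + 1), fun f => (f.1, f.2.1, f.2.2 - 1), fun f => by simp, fun f => by simp⟩
  let Vsh : Equiv.Perm (ℤ × ℤ × ℤ) :=
    ⟨fun f => (f.1 + 1, f.2.1, f.2.2), fun f => (f.1 - 1, f.2.1, f.2.2), fun f => by simp, fun f => by simp⟩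
  have hI1 : ∀ f, Ish f = (f.1, f.2.1 + 1, f.2.2) := fun f => rfl
  have hI2 : ∀ f, Ish⁻¹ f = (f.1, f.2.1 - 1, f.2.2) := fun f => rfl
  have hJ1 : ∀ f, Jsh f = (f.1, f.2.1, f.2.2 + 1) := fun f => rfl
  have hJ2 : ∀ f, Jsh⁻¹ f = (f.1, f.2.1, f.2.2 - 1) := fun f => rfl
  have hV1 : ∀ f, Vsh f = (f.1 + 1, f.2.1, f.2.2) := fun f => rfl
  have hV2 : ∀ f, Vsh⁻¹ f = (f.1 - 1, f.2.1, f.2.2) := fun f => rfl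
  have hIpow : ∀ (n : ℤ) (f : ℤ × ℤ × ℤ), (Ish ^ n) f = (f.1, f.2.1 + n, f.2.2) := by
    intro n
    induction n using Int.induction_on with
    | zero => intro f; simp
    | succ n ih =>
      intro f; rw [zpow_add_one, Equiv.Perm.mul_apply, ih, hI1]
      refine Prod.ext rfl (Prod.ext ?_ rfl); dsimp only; ring
    | pred n ih =>
      intro f; rw [zpow_sub_one, Equiv.Perm.mul_apply, ih, hI2]
      refine Prod.ext rfl (Prod.ext ?_ rfl); dsimp only; ring
  have hJpow : ∀ (n : ℤ) (f : ℤ × ℤ × ℤ), (Jsh ^ n) f = (f.1, f.2.1, f.2.2 + n) := by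
    intro n
    induction n using Int.induction_on with
    | zero => intro f; simp
    | succ n ih =>
      intro f; rw [zpow_add_one, Equiv.Perm.mul_apply, ih, hJ1]
      refine Prod.ext rfl (Prod.ext rfl ?_); dsimp only; ring
    | pred n ih =>
      intro f; rw [zpow_sub_one, Equiv.Perm.mul_apply, ih, hJ2]
      refine Prod.ext rfl (Prod.ext rfl ?_); dsimp only; ring
  have hVpow : ∀ (n : ℤ) (f : ℤ × ℤ × ℤ), (Vsh ^ n) f = (f.1 + n, f.2.1, f.2.2) := by
    intro n
    induction n using Int.induction_on with
    | zero => intro f; simp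
    | succ n ih =>
      intro f; rw [zpow_add_one, Equiv.Perm.mul_apply, ih, hV1]
      refine Prod.ext ?_ rfl; dsimp only; ring
    | pred n ih =>
      intro f; rw [zpow_sub_one, Equiv.Perm.mul_apply, ih, hV2]
      refine Prod.ext ?_ rfl; dsimp only; ring
  -- the composite used in STAR / LINK
  have hcomp : ∀ (f : ℤ × ℤ × ℤ) (y : ℤ × ℤ × ℤ),
      (Vsh ^ y.1) ((Jsh ^ (-y.2.2)) ((Ish ^ (-y.2.1)) f)) = (f.1 + y.1, f.2.1 - y.2.1, f.2.2 - y.2.2) := by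
    intro f y
    rw [hIpow, hJpow, hVpow]
    refine Prod.ext rfl (Prod.ext ?_ ?_) <;> dsimp only <;> ring
  -- points and parities
  let ptF : ℤ × ℤ × ℤ → (EuclideanSpace ℝ (Fin 3)) := fun f => (frameAt Pc nb g₀ f.1 f.2.1 f.2.2).pt
  let par : ℤ × ℤ × ℤ → ℤ := fun f =>
    frameParity (frameAt Pc nb g₀ f.1 f.2.1 f.2.2).t₁ (frameAt Pc nb g₀ f.1 f.2.1 f.2.2).t₂
      (frameAt Pc nb g₀ f.1 f.2.1 f.2.2).U
  -- STAR / LINK at `f`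
  have hstar : ∀ f : ℤ × ℤ × ℤ,
      Set.BijOn (fun y : ℤ × ℤ × ℤ => ptF ((Vsh ^ y.1) ((Jsh ^ (-y.2.2)) ((Ish ^ (-y.2.1)) f))))
        (↑(linkOffsets (par (Vsh⁻¹ f)) (par f)) : Set (ℤ × ℤ × ℤ))
        {z | z ∈ S ∧ (0 < dist (ptF f) z ∧ dist (ptF f) z ≤ 28 / 25)} ∧
      ∀ y ∈ linkOffsets (par (Vsh⁻¹ f)) (par f), ∀ y' ∈ linkOffsets (par (Vsh⁻¹ f)) (par f),
        ((0 < dist (ptF ((Vsh ^ y.1) ((Jsh ^ (-y.2.2)) ((Ish ^ (-y.2.1)) f))))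
              (ptF ((Vsh ^ y'.1) ((Jsh ^ (-y'.2.2)) ((Ish ^ (-y'.2.1)) f)))) ∧
          dist (ptF ((Vsh ^ y.1) ((Jsh ^ (-y.2.2)) ((Ish ^ (-y.2.1)) f))))
              (ptF ((Vsh ^ y'.1) ((Jsh ^ (-y'.2.2)) ((Ish ^ (-y'.2.1)) f)))) ≤ 28 / 25) ↔
          linkAdj (par (Vsh⁻¹ f)) (par f) y y') := by
    intro f
    rcases h : frameAt Pc nb g₀ f.1 f.2.1 f.2.2 with ⟨x, t₁, t₂, U⟩
    have hσp : frameParity t₁ t₂ U = par f := by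
      show _ = frameParity _ _ _; rw [h]
    have hσm : lowerParity t₁ t₂ (lowerCap (Pc x) t₁ t₂ U) = par (Vsh⁻¹ f) := by
      have := lowerParity_eq_par_below (Pc := Pc) (nb := nb) hch h₀ h₀S h₀p h₀A f.1 f.2.1 f.2.2
      rw [h] at this
      exact this
    have hx : ptF f = x := by show (frameAt Pc nb g₀ f.1 f.2.1 f.2.2).pt = x; rw [h]
    obtain ⟨hbij, hlink⟩ := star_at hch h₀ h₀S h₀p h₀A f.1 f.2.1 f.2.2 h hσp hσm
    have e : (fun y : ℤ × ℤ × ℤ => ptF ((Vsh ^ y.1) ((Jsh ^ (-y.2.2)) ((Ish ^ (-y.2.1)) f)))) =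
        fun y : ℤ × ℤ × ℤ => (frameAt Pc nb g₀ (f.1 + y.1) (f.2.1 - y.2.1) (f.2.2 - y.2.2)).pt := by
      funext y; simp only [ptF, hcomp]
    refine ⟨?_, ?_⟩
    · rw [e, hx]; exact hbij
    · intro y hy y' hy'
      have := hlink y hy y' hy'
      simp only [ptF, hcomp]
      exact this
  refine ⟨ℤ × ℤ × ℤ, ptF, Ish, Jsh, Vsh, par, ((0 : ℤ), (0 : ℤ), (0 : ℤ)), fun f => rfl, fun f => rfl, fun f => rfl,
    fun f => hS f.1 f.2.1 f.2.2, fun f => frameParity_eq_or _ _ _,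
    fun f => (par_IJ (Pc := Pc) (nb := nb) hch h₀ h₀S h₀p h₀A f.1 f.2.1 f.2.2).1,
    fun f => (par_IJ (Pc := Pc) (nb := nb) hch h₀ h₀S h₀p h₀A f.1 f.2.1 f.2.2).2, ?_,
    fun f => (hstar f).1, fun f => (hstar f).2⟩
  -- reachability
  intro y hy
  obtain ⟨w⟩ := hconn g₀.pt h₀S y hy
  obtain ⟨k, i, j, hk⟩ := reach (Pc := Pc) (nb := nb) hch h₀ h₀S h₀p h₀A w ⟨0, 0, 0, rfl⟩
  refine ⟨i, j, k, ?_⟩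
  show (frameAt Pc nb g₀ ((Vsh ^ k) ((Jsh ^ j) ((Ish ^ i) (0, 0, 0)))).1 _ _).pt = y
  simp only [hIpow, hJpow, hVpow, zero_add]
  exact hk
end Summit.AtomisticToContinuum.Crystallization.Theorems.PalmUnimodularRigidityShellsToBarlowChart.Clean

end
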